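import Literature.NumberTheory.LFunctions.DirichletLTruncationCertificatesOdd
import HarnessLib

/-!
# No real zero for the ODD real primitive characters of conductor `901 ≤ q ≤ 950`, in the kernel
# (truncation certificates with drift)

Topic `Literature/NumberTheory/LFunctions`; namespace `Literature.NumberTheory.LFunctions`
(private per-modulus work in `Literature.NumberTheory.LFunctions.OddTruncationIVa`). THEOREMS only (no
definition, no named fact, no `sorry`): **`noRealZeroOdd_range_901_950`** — for every modulus
`901 ≤ q ≤ 950`, every primitive quadratic ODD `χ` mod `q` (imaginary quadratic fields of discriminant `−q`)
and every `σ ∈ (0, 1)`, `L(σ, χ) ≠ 0`.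

Per modulus (one bullet each, in the order of `interval_cases`): moduli without a primitive quadratic
character are dismissed (`q ≡ 2 (mod 4)`, `16 ∣ q`, `p² ∣ q` — MV Thm 9.13); the EVEN primitive quadratic
character is excluded by the parity test inside `LTruncationCert.good_odd_of_*`; the ODD one is certified by
**`LTruncationCert.certDriftOK v q K J P`** (`DirichletLTruncationCertificatesOdd.lean`): the truncation
`∑_{n ≤ Kq} χ(n) n^{−σ}` after `K` periods dominates the one-sided second-order tail bound `B⁻/(2(Kq+1)^{3/2})`
(`B⁻ = max_N (−U(N))⁺`; the drift `U(q) = q·h(−q) > 0` only helps) on each of `J` cells covering `[1/2, 1]`,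
and the functional equation reflects `(0, 1/2)` to `(1/2, 1)`.  15 certificates in this file (parameters
and margins in the docstrings; `K > 1` / `J > 16` only where the one-period truncation is too small at
`σ = 1/2`). [cite: Chua2005RealZeros, §2.2 ALGO 1]

## References

* K. S. Chua, *Real zeros of Dedekind zeta functions of real quadratic fields*, Math. Comp. 74 (2005)
  1457–1470, §2. [Chua2005RealZeros]
* M. Watkins, *Real zeros of real odd Dirichlet L-functions*, Math. Comp. 73 (2004) 415–423.
  [Watkins2004RealZeros]
* H. L. Montgomery, R. C. Vaughan, *Multiplicative Number Theory I*, CUP 2007, §9.3 Thm 9.13, §10.1.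
  [MontgomeryVaughan2007]
-/

namespace Literature.NumberTheory.LFunctions

namespace OddTruncationIVa

open FeketePolyaKernel PrimitiveQuadratic LTruncationCert

/-- Conductor `≡ 2 (mod 4)`: no primitive character (private copy of the sweep-4 lemma).
[cite: MontgomeryVaughan2007, §9.3 Theorem 9.13] -/
private theorem absurd_of_mod_four_two {q : ℕ} [NeZero q] (hq : q % 4 = 2)
    {χ : DirichletCharacter ℂ q} (hprim : χ.IsPrimitive) : False := by
  obtain ⟨m, rfl⟩ : ∃ m, q = 2 * m := ⟨q / 2, by omega⟩
  haveI : NeZero m := ⟨by omega⟩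
  exact not_isPrimitive_two_mul (m := m) (Nat.odd_iff.mpr (by omega)) hprim

/-- Conductor divisible by `16`: no primitive quadratic character (private copy).
[cite: MontgomeryVaughan2007, §9.3 Theorem 9.13] -/
private theorem absurd_of_sixteen_dvd {q : ℕ} [NeZero q] (hq : q % 16 = 0) {χ : DirichletCharacter ℂ q}
    (hprim : χ.IsPrimitive) (hquad : χ.IsQuadratic) : False := by
  obtain ⟨k, m, hm, rfl⟩ := Nat.exists_eq_two_pow_mul_odd (NeZero.ne q)
  have hm2 := Nat.odd_iff.mp hm
  haveI : NeZero m := ⟨by omega⟩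
  have hk := le_three_of_level_two_pow_mul hm hprim hquad
  interval_cases k <;> norm_num at hq <;> omega

/-- Conductor with an odd square factor `p²`: no primitive quadratic character (private copy).
[cite: MontgomeryVaughan2007, §9.3 Theorem 9.13] -/
private theorem absurd_of_sq_dvd {q : ℕ} [NeZero q] {p : ℕ} (hp : p.Prime) (hp2 : p ≠ 2)
    (hpq : p * p ∣ q) {χ : DirichletCharacter ℂ q} (hprim : χ.IsPrimitive) (hquad : χ.IsQuadratic) :
    False := by
  obtain ⟨k, m, hm, rfl⟩ := Nat.exists_eq_two_pow_mul_odd (NeZero.ne q)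
  have hm2 := Nat.odd_iff.mp hm
  haveI : NeZero m := ⟨by omega⟩
  have hsq := squarefree_of_level_two_pow_mul hm hprim hquad
  have hp2' : Nat.Coprime p 2 := (Nat.coprime_primes hp Nat.prime_two).mpr hp2
  have hcop : Nat.Coprime (p * p) (2 ^ k) := Nat.Coprime.pow_right k (Nat.Coprime.mul_left hp2' hp2')
  have hpm : p * p ∣ m := hcop.dvd_of_dvd_mul_left hpq
  exact hp.one_lt.ne' (Nat.isUnit_iff.mp (hsq p hpm))

/-- `903`: the odd character `(·/903)` = `χ_{−903}` — drift certificate `K = 1`, `J = 16`, `P = 32` (`B⁻ = 0`, worst cell margin `1.362`). [cite: Chua2005RealZeros, §2.2 ALGO 1] -/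
private theorem goodOdd903 :
    ∀ χ : DirichletCharacter ℂ 903, χ.IsQuadratic → χ.IsPrimitive → χ.Odd →
      ∀ σ : ℝ, 0 < σ → σ < 1 → χ.LFunction σ ≠ 0 :=
  good_odd_of_odd (by decide) (by decide) 1 16 32 (by decide +kernel)

/-- `904 = 8·113`: the odd character `χ₋₈·(·/113)` = `χ_{−904}` — drift certificate `K = 1`, `J = 16`, `P = 32` (`B⁻ = 0`, worst cell margin `0.669`); the other primitive quadratic character mod `904` is even (parity test). [cite: Chua2005RealZeros, §2.2 ALGO 1] -/
private theorem goodOdd904 :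
    ∀ χ : DirichletCharacter ℂ 904, χ.IsQuadratic → χ.IsPrimitive → χ.Odd →
      ∀ σ : ℝ, 0 < σ → σ < 1 → χ.LFunction σ ≠ 0 :=
  good_odd_of_eight (by decide) (by decide) 1 16 32 (by decide +kernel) (by decide +kernel)

/-- `907`: the odd character `(·/907)` = `χ_{−907}` — drift certificate `K = 1`, `J = 16`, `P = 32` (`B⁻ = 859`, worst cell margin `0.009`). [cite: Chua2005RealZeros, §2.2 ALGO 1] -/
private theorem goodOdd907 :
    ∀ χ : DirichletCharacter ℂ 907, χ.IsQuadratic → χ.IsPrimitive → χ.Odd →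
      ∀ σ : ℝ, 0 < σ → σ < 1 → χ.LFunction σ ≠ 0 :=
  good_odd_of_odd (by decide) (by decide) 1 16 32 (by decide +kernel)

/-- `911`: the odd character `(·/911)` = `χ_{−911}` — drift certificate `K = 1`, `J = 16`, `P = 32` (`B⁻ = 0`, worst cell margin `2.685`). [cite: Chua2005RealZeros, §2.2 ALGO 1] -/
private theorem goodOdd911 :
    ∀ χ : DirichletCharacter ℂ 911, χ.IsQuadratic → χ.IsPrimitive → χ.Odd →
      ∀ σ : ℝ, 0 < σ → σ < 1 → χ.LFunction σ ≠ 0 :=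
  good_odd_of_odd (by decide) (by decide) 1 16 32 (by decide +kernel)

/-- `915`: the odd character `(·/915)` = `χ_{−915}` — drift certificate `K = 1`, `J = 16`, `P = 32` (`B⁻ = 0`, worst cell margin `0.672`). [cite: Chua2005RealZeros, §2.2 ALGO 1] -/
private theorem goodOdd915 :
    ∀ χ : DirichletCharacter ℂ 915, χ.IsQuadratic → χ.IsPrimitive → χ.Odd →
      ∀ σ : ℝ, 0 < σ → σ < 1 → χ.LFunction σ ≠ 0 :=
  good_odd_of_odd (by decide) (by decide) 1 16 32 (by decide +kernel)

/-- `916 = 4·229`: the odd character `χ₋₄·(·/229)` = `χ_{−916}` — drift certificate `K = 1`, `J = 16`, `P = 32` (`B⁻ = 0`, worst cell margin `0.841`). [cite: Chua2005RealZeros, §2.2 ALGO 1] -/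
private theorem goodOdd916 :
    ∀ χ : DirichletCharacter ℂ 916, χ.IsQuadratic → χ.IsPrimitive → χ.Odd →
      ∀ σ : ℝ, 0 < σ → σ < 1 → χ.LFunction σ ≠ 0 :=
  good_odd_of_four (by decide) (by decide) 1 16 32 (by decide +kernel)

/-- `919`: the odd character `(·/919)` = `χ_{−919}` — drift certificate `K = 1`, `J = 16`, `P = 32` (`B⁻ = 0`, worst cell margin `1.622`). [cite: Chua2005RealZeros, §2.2 ALGO 1] -/
private theorem goodOdd919 :
    ∀ χ : DirichletCharacter ℂ 919, χ.IsQuadratic → χ.IsPrimitive → χ.Odd →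
      ∀ σ : ℝ, 0 < σ → σ < 1 → χ.LFunction σ ≠ 0 :=
  good_odd_of_odd (by decide) (by decide) 1 16 32 (by decide +kernel)

/-- `920 = 8·115`: the odd character `χ₈·(·/115)` = `χ_{−920}` — drift certificate `K = 1`, `J = 16`, `P = 32` (`B⁻ = 0`, worst cell margin `1.716`); the other primitive quadratic character mod `920` is even (parity test). [cite: Chua2005RealZeros, §2.2 ALGO 1] -/
private theorem goodOdd920 :
    ∀ χ : DirichletCharacter ℂ 920, χ.IsQuadratic → χ.IsPrimitive → χ.Odd →
      ∀ σ : ℝ, 0 < σ → σ < 1 → χ.LFunction σ ≠ 0 :=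
  good_odd_of_eight (by decide) (by decide) 1 16 32 (by decide +kernel) (by decide +kernel)

/-- `923`: the odd character `(·/923)` = `χ_{−923}` — drift certificate `K = 1`, `J = 16`, `P = 32` (`B⁻ = 0`, worst cell margin `0.841`). [cite: Chua2005RealZeros, §2.2 ALGO 1] -/
private theorem goodOdd923 :
    ∀ χ : DirichletCharacter ℂ 923, χ.IsQuadratic → χ.IsPrimitive → χ.Odd →
      ∀ σ : ℝ, 0 < σ → σ < 1 → χ.LFunction σ ≠ 0 :=
  good_odd_of_odd (by decide) (by decide) 1 16 32 (by decide +kernel)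

/-- `932 = 4·233`: the odd character `χ₋₄·(·/233)` = `χ_{−932}` — drift certificate `K = 1`, `J = 16`, `P = 32` (`B⁻ = 0`, worst cell margin `1.000`). [cite: Chua2005RealZeros, §2.2 ALGO 1] -/
private theorem goodOdd932 :
    ∀ χ : DirichletCharacter ℂ 932, χ.IsQuadratic → χ.IsPrimitive → χ.Odd →
      ∀ σ : ℝ, 0 < σ → σ < 1 → χ.LFunction σ ≠ 0 :=
  good_odd_of_four (by decide) (by decide) 1 16 32 (by decide +kernel)

/-- `935`: the odd character `(·/935)` = `χ_{−935}` — drift certificate `K = 1`, `J = 16`, `P = 32` (`B⁻ = 0`, worst cell margin `2.385`). [cite: Chua2005RealZeros, §2.2 ALGO 1] -/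
private theorem goodOdd935 :
    ∀ χ : DirichletCharacter ℂ 935, χ.IsQuadratic → χ.IsPrimitive → χ.Odd →
      ∀ σ : ℝ, 0 < σ → σ < 1 → χ.LFunction σ ≠ 0 :=
  good_odd_of_odd (by decide) (by decide) 1 16 32 (by decide +kernel)

/-- `939`: the odd character `(·/939)` = `χ_{−939}` — drift certificate `K = 1`, `J = 16`, `P = 32` (`B⁻ = 0`, worst cell margin `0.662`). [cite: Chua2005RealZeros, §2.2 ALGO 1] -/
private theorem goodOdd939 :
    ∀ χ : DirichletCharacter ℂ 939, χ.IsQuadratic → χ.IsPrimitive → χ.Odd →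
      ∀ σ : ℝ, 0 < σ → σ < 1 → χ.LFunction σ ≠ 0 :=
  good_odd_of_odd (by decide) (by decide) 1 16 32 (by decide +kernel)

/-- `943`: the odd character `(·/943)` = `χ_{−943}` — drift certificate `K = 1`, `J = 16`, `P = 32` (`B⁻ = 0`, worst cell margin `1.339`). [cite: Chua2005RealZeros, §2.2 ALGO 1] -/
private theorem goodOdd943 :
    ∀ χ : DirichletCharacter ℂ 943, χ.IsQuadratic → χ.IsPrimitive → χ.Odd →
      ∀ σ : ℝ, 0 < σ → σ < 1 → χ.LFunction σ ≠ 0 :=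
  good_odd_of_odd (by decide) (by decide) 1 16 32 (by decide +kernel)

/-- `947`: the odd character `(·/947)` = `χ_{−947}` — drift certificate `K = 1`, `J = 16`, `P = 32` (`B⁻ = 332`, worst cell margin `0.131`). [cite: Chua2005RealZeros, §2.2 ALGO 1] -/
private theorem goodOdd947 :
    ∀ χ : DirichletCharacter ℂ 947, χ.IsQuadratic → χ.IsPrimitive → χ.Odd →
      ∀ σ : ℝ, 0 < σ → σ < 1 → χ.LFunction σ ≠ 0 :=
  good_odd_of_odd (by decide) (by decide) 1 16 32 (by decide +kernel)

/-- `948 = 4·237`: the odd character `χ₋₄·(·/237)` = `χ_{−948}` — drift certificate `K = 1`, `J = 16`, `P = 32` (`B⁻ = 0`, worst cell margin `0.998`). [cite: Chua2005RealZeros, §2.2 ALGO 1] -/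
private theorem goodOdd948 :
    ∀ χ : DirichletCharacter ℂ 948, χ.IsQuadratic → χ.IsPrimitive → χ.Odd →
      ∀ σ : ℝ, 0 < σ → σ < 1 → χ.LFunction σ ≠ 0 :=
  good_odd_of_four (by decide) (by decide) 1 16 32 (by decide +kernel)

/-- **No real zero in `(0, 1)` for every odd real primitive character of conductor `901 ≤ q ≤ 950`**
(one bullet per modulus, in the order of `interval_cases`). [cite: Chua2005RealZeros, §2.2 ALGO 1] -/
theorem range_901_950 (q : ℕ) [NeZero q] (hlo : 900 < q) (hhi : q ≤ 950) :
    ∀ χ : DirichletCharacter ℂ q, χ.IsQuadratic → χ.IsPrimitive → χ.Odd →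
      ∀ σ : ℝ, 0 < σ → σ < 1 → χ.LFunction σ ≠ 0 := by
  interval_cases q
  · -- 901 ≡ 1 (mod 4): the primitive quadratic character (·/901) is even (parity test)
    exact good_odd_of_odd (by decide) (by decide) 1 16 32 (by decide +kernel)
  · -- 902 ≡ 2 (mod 4): no primitive character
    exact fun χ _ hprim _ ↦ (absurd_of_mod_four_two (by decide) hprim).elim
  · exact goodOdd903 -- certificate
  · exact goodOdd904 -- certificate
  · -- 905 ≡ 1 (mod 4): the primitive quadratic character (·/905) is even (parity test)
    exact good_odd_of_odd (by decide) (by decide) 1 16 32 (by decide +kernel)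
  · -- 906 ≡ 2 (mod 4): no primitive character
    exact fun χ _ hprim _ ↦ (absurd_of_mod_four_two (by decide) hprim).elim
  · exact goodOdd907 -- certificate
  · -- 908 = 4·227, 227 ≡ 3 (mod 4): the primitive quadratic character is even (parity test)
    exact good_odd_of_four (by decide) (by decide) 1 16 32 (by decide +kernel)
  · -- 3² ∣ 909: no primitive quadratic character
    exact fun χ hquad hprim _ ↦
      (absurd_of_sq_dvd (p := 3) (by norm_num) (by decide) (by decide) hprim hquad).elim
  · -- 910 ≡ 2 (mod 4): no primitive character
    exact fun χ _ hprim _ ↦ (absurd_of_mod_four_two (by decide) hprim).elim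
  · exact goodOdd911 -- certificate
  · -- 16 ∣ 912: no primitive quadratic character
    exact fun χ hquad hprim _ ↦ (absurd_of_sixteen_dvd (by decide) hprim hquad).elim
  · -- 913 ≡ 1 (mod 4): the primitive quadratic character (·/913) is even (parity test)
    exact good_odd_of_odd (by decide) (by decide) 1 16 32 (by decide +kernel)
  · -- 914 ≡ 2 (mod 4): no primitive character
    exact fun χ _ hprim _ ↦ (absurd_of_mod_four_two (by decide) hprim).elim
  · exact goodOdd915 -- certificate
  · exact goodOdd916 -- certificate
  · -- 917 ≡ 1 (mod 4): the primitive quadratic character (·/917) is even (parity test)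
    exact good_odd_of_odd (by decide) (by decide) 1 16 32 (by decide +kernel)
  · -- 918 ≡ 2 (mod 4): no primitive character
    exact fun χ _ hprim _ ↦ (absurd_of_mod_four_two (by decide) hprim).elim
  · exact goodOdd919 -- certificate
  · exact goodOdd920 -- certificate
  · -- 921 ≡ 1 (mod 4): the primitive quadratic character (·/921) is even (parity test)
    exact good_odd_of_odd (by decide) (by decide) 1 16 32 (by decide +kernel)
  · -- 922 ≡ 2 (mod 4): no primitive character
    exact fun χ _ hprim _ ↦ (absurd_of_mod_four_two (by decide) hprim).elim
  · exact goodOdd923 -- certificate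
  · -- 924 = 4·231, 231 ≡ 3 (mod 4): the primitive quadratic character is even (parity test)
    exact good_odd_of_four (by decide) (by decide) 1 16 32 (by decide +kernel)
  · -- 5² ∣ 925: no primitive quadratic character
    exact fun χ hquad hprim _ ↦
      (absurd_of_sq_dvd (p := 5) (by norm_num) (by decide) (by decide) hprim hquad).elim
  · -- 926 ≡ 2 (mod 4): no primitive character
    exact fun χ _ hprim _ ↦ (absurd_of_mod_four_two (by decide) hprim).elim
  · -- 3² ∣ 927: no primitive quadratic character
    exact fun χ hquad hprim _ ↦
      (absurd_of_sq_dvd (p := 3) (by norm_num) (by decide) (by decide) hprim hquad).elim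
  · -- 16 ∣ 928: no primitive quadratic character
    exact fun χ hquad hprim _ ↦ (absurd_of_sixteen_dvd (by decide) hprim hquad).elim
  · -- 929 ≡ 1 (mod 4): the primitive quadratic character (·/929) is even (parity test)
    exact good_odd_of_odd (by decide) (by decide) 1 16 32 (by decide +kernel)
  · -- 930 ≡ 2 (mod 4): no primitive character
    exact fun χ _ hprim _ ↦ (absurd_of_mod_four_two (by decide) hprim).elim
  · -- 7² ∣ 931: no primitive quadratic character
    exact fun χ hquad hprim _ ↦
      (absurd_of_sq_dvd (p := 7) (by norm_num) (by decide) (by decide) hprim hquad).elim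
  · exact goodOdd932 -- certificate
  · -- 933 ≡ 1 (mod 4): the primitive quadratic character (·/933) is even (parity test)
    exact good_odd_of_odd (by decide) (by decide) 1 16 32 (by decide +kernel)
  · -- 934 ≡ 2 (mod 4): no primitive character
    exact fun χ _ hprim _ ↦ (absurd_of_mod_four_two (by decide) hprim).elim
  · exact goodOdd935 -- certificate
  · -- 3² ∣ 936: no primitive quadratic character
    exact fun χ hquad hprim _ ↦
      (absurd_of_sq_dvd (p := 3) (by norm_num) (by decide) (by decide) hprim hquad).elim
  · -- 937 ≡ 1 (mod 4): the primitive quadratic character (·/937) is even (parity test)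
    exact good_odd_of_odd (by decide) (by decide) 1 16 32 (by decide +kernel)
  · -- 938 ≡ 2 (mod 4): no primitive character
    exact fun χ _ hprim _ ↦ (absurd_of_mod_four_two (by decide) hprim).elim
  · exact goodOdd939 -- certificate
  · -- 940 = 4·235, 235 ≡ 3 (mod 4): the primitive quadratic character is even (parity test)
    exact good_odd_of_four (by decide) (by decide) 1 16 32 (by decide +kernel)
  · -- 941 ≡ 1 (mod 4): the primitive quadratic character (·/941) is even (parity test)
    exact good_odd_of_odd (by decide) (by decide) 1 16 32 (by decide +kernel)
  · -- 942 ≡ 2 (mod 4): no primitive character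
    exact fun χ _ hprim _ ↦ (absurd_of_mod_four_two (by decide) hprim).elim
  · exact goodOdd943 -- certificate
  · -- 16 ∣ 944: no primitive quadratic character
    exact fun χ hquad hprim _ ↦ (absurd_of_sixteen_dvd (by decide) hprim hquad).elim
  · -- 3² ∣ 945: no primitive quadratic character
    exact fun χ hquad hprim _ ↦
      (absurd_of_sq_dvd (p := 3) (by norm_num) (by decide) (by decide) hprim hquad).elim
  · -- 946 ≡ 2 (mod 4): no primitive character
    exact fun χ _ hprim _ ↦ (absurd_of_mod_four_two (by decide) hprim).elim
  · exact goodOdd947 -- certificate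
  · exact goodOdd948 -- certificate
  · -- 949 ≡ 1 (mod 4): the primitive quadratic character (·/949) is even (parity test)
    exact good_odd_of_odd (by decide) (by decide) 1 16 32 (by decide +kernel)
  · -- 950 ≡ 2 (mod 4): no primitive character
    exact fun χ _ hprim _ ↦ (absurd_of_mod_four_two (by decide) hprim).elim

end OddTruncationIVa

open OddTruncationIVa in
/-- **Odd real primitive characters of conductor `901 ≤ q ≤ 950` have no real zero in `(0, 1)`.**
[cite: Watkins2004RealZeros, main theorem (d ≤ 3·10⁸, here re-proved in the kernel for this range)] -/
theorem noRealZeroOdd_range_901_950 (q : ℕ) [NeZero q] (hlo : 900 < q) (hhi : q ≤ 950) :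
    ∀ χ : DirichletCharacter ℂ q, χ.IsQuadratic → χ.IsPrimitive → χ.Odd →
      ∀ σ : ℝ, 0 < σ → σ < 1 → χ.LFunction σ ≠ 0 :=
  range_901_950 q hlo hhi

end Literature.NumberTheory.LFunctions
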